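import Summits.NavierStokesRegularity.NavierStokesRegularity.Theorems.SelfMixingDichotomyCoherentScaleExclusionSelfSimilarSwirlLoadFloor
import HarnessLib

/-!
# Route SelfMixingDichotomy — crux `SequentialTypeIExclusion` (S1, stmt-NavierStokesRegularity-1424),
# line `registered`, lead c6 (pulsating witness package): stub W5 `pulse_unbounded`

Support file (`--supports stmt-NavierStokesRegularity-1424`) landing the registered stub `pulse_unbounded` of
the pulsating kinematic witness package: the pulsating self-similar swirling eddy

  `u t x = (a t · (1 − t)⁻¹ · expNegInvGlue (4 − ‖x‖² / (1 − t))) • (−x₁, x₀, 0)`   (`t < 1`; `0` after)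

is UNBOUNDED on every parabolic neighbourhood `(1 − ρ², 1) × B(0, ρ)` of its tip `(1, 0)`, as soon as the
amplitude `a` is nonnegative before `t = 1` and `a ≥ 2ⁿ` on the `n`-th peak window
`t ∈ (1 − pₙ²/4, 1 − pₙ²/5)`, `pₙ = (2^{2n²})⁻¹`.

Proof. Given `ρ > 0` and `M`, pick `n` with `pₙ ≤ (2ⁿ)⁻¹ < ρ` and `2ⁿ · expNegInvGlue 1 · (11/5) > M`; put
`r = pₙ`, `t = 1 − 9r²/40` (the midpoint of the peak window, inside `(1 − ρ², 1)`) and `x = (3r/5) e₀`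
(`‖x‖ = 3r/5 < ρ`). At the fixed time `t` the slice is the sibling crux S2's slice with the constant amplitude
`A := a t ≥ 2ⁿ`, so `selfSimilarSwirl_loadFloor_pointwise` gives
`‖u t x‖ ≥ a t · (4/r²) · expNegInvGlue 1 · (11r/20) ≥ 2ⁿ · expNegInvGlue 1 · (11/5) / r ≥ 2ⁿ · expNegInvGlue 1 · (11/5) > M`
(`0 < r ≤ 1`). Mathlib plus the landed sibling file `…SelfSimilarSwirlLoadFloor`; no definition, no named fact
taken as a hypothesis.
-/

noncomputable section

open MeasureTheory Set Metric
open scoped ENNReal ContDiff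
open Literature.Analysis.FluidPDE

-- `Summit = Problem` for this summit; the tree lakefile sets `weak.linter.dupNamespace = false`.
set_option linter.dupNamespace false

namespace Summit.NavierStokesRegularity.NavierStokesRegularity.Theorems.SequentialTypeIExclusion.Registered

/-- Choice of the pulse index: for `ρ > 0`, `c > 0` and any `M` there is an `n` with peak scale
`(2^{2n²})⁻¹ < ρ` and `M < 2ⁿ · c` (both via `n < 2ⁿ ≤ 2^{2n²}`). -/
theorem pulse_unbounded_index (ρ c M : ℝ) (hρ : 0 < ρ) (hc : 0 < c) :
    ∃ n : ℕ, ((2 : ℝ) ^ (2 * n ^ 2))⁻¹ < ρ ∧ M < (2 : ℝ) ^ n * c := by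
  obtain ⟨k, hk⟩ := exists_nat_gt (max ρ⁻¹ (M / c))
  have h1 : (k : ℝ) < (2 : ℝ) ^ k := by exact_mod_cast Nat.lt_two_pow_self
  refine ⟨k, ?_, ?_⟩
  · have h2 : (2 : ℝ) ^ k ≤ (2 : ℝ) ^ (2 * k ^ 2) :=
      pow_le_pow_right₀ (by norm_num) (by nlinarith)
    rw [inv_lt_comm₀ (by positivity) hρ]
    have := le_max_left ρ⁻¹ (M / c)
    linarith
  · have := le_max_right ρ⁻¹ (M / c)
    have h3 : M / c < (2 : ℝ) ^ k := by linarith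
    rwa [div_lt_iff₀ hc] at h3

/-- **W5 — unboundedness of the pulsating eddy at `(1, 0)`** (registered sub-goal `pulse_unbounded` of the crux
`SequentialTypeIExclusion`, line `registered`, lead c6). If `a ≥ 0` before `t = 1` and `a ≥ 2ⁿ` on the peak
windows `t ∈ (1 − pₙ²/4, 1 − pₙ²/5)`, `pₙ = (2^{2n²})⁻¹`, then `u` exceeds every bound `M` on every
`(1 − ρ², 1) × B(0, ρ)`: at `t = 1 − 9pₙ²/40`, `x = (3pₙ/5) e₀` the speed is
`≥ 2ⁿ (4/pₙ²) expNegInvGlue 1 (11pₙ/20) ≥ 2ⁿ · expNegInvGlue 1 · (11/5)`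
(`selfSimilarSwirl_loadFloor_pointwise` with `A = a t`, `pₙ ≤ 1`), and `pₙ → 0`. -/
theorem pulse_unbounded :
    ∀ a : ℝ → ℝ, (∀ t : ℝ, t < 1 → 0 ≤ a t) →
      (∀ (n : ℕ), ∀ t ∈ Set.Ioo (1 - (((2 : ℝ) ^ (2 * n ^ 2))⁻¹) ^ 2 / 4) (1 - (((2 : ℝ) ^ (2 * n ^ 2))⁻¹) ^ 2 / 5),
        (2 : ℝ) ^ n ≤ a t) →
      ∀ ρ : ℝ, 0 < ρ → ∀ M : ℝ, ∃ t ∈ Set.Ioo (1 - ρ ^ 2) 1,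
        ∃ x ∈ Metric.ball (0 : EuclideanSpace ℝ (Fin 3)) ρ,
          M < ‖(fun (t : ℝ) (x : EuclideanSpace ℝ (Fin 3)) => if t < 1 then
            (a t * (1 - t)⁻¹ * expNegInvGlue (4 - ‖x‖ ^ 2 / (1 - t))) •
              (WithLp.toLp 2 ![-(x 1), x 0, 0] : EuclideanSpace ℝ (Fin 3)) else 0) t x‖ := by
  intro a ha hpk ρ hρ M
  have hg : 0 < expNegInvGlue 1 := expNegInvGlue.pos_of_pos one_pos
  have hc : 0 < expNegInvGlue 1 * (11 / 5) := by positivity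
  -- the pulse index `n`, the peak scale `r = pₙ ∈ (0, 1]`, `r < ρ`
  obtain ⟨n, hnρ, hnM⟩ := pulse_unbounded_index ρ (expNegInvGlue 1 * (11 / 5)) M hρ hc
  set r : ℝ := ((2 : ℝ) ^ (2 * n ^ 2))⁻¹ with hr_def
  have hr : 0 < r := by positivity
  have hr1 : r ≤ 1 := inv_le_one_of_one_le₀ (one_le_pow₀ (by norm_num))
  have hr2 : 0 < r ^ 2 := pow_pos hr 2
  have hrρ2 : r ^ 2 < ρ ^ 2 := by nlinarith
  -- the time `t = 1 − 9r²/40` (midpoint of the peak window) and the point `x = (3r/5) e₀`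
  have ht : (1 - 9 * r ^ 2 / 40) ∈ Set.Ioo (1 - r ^ 2 / 4) (1 - r ^ 2 / 5) := by
    constructor <;> linarith
  have ht1 : 1 - 9 * r ^ 2 / 40 < 1 := by linarith
  have hx : (EuclideanSpace.single 0 (3 * r / 5) : EuclideanSpace ℝ (Fin 3)) ∈
      Metric.ball (EuclideanSpace.single 0 (3 * r / 5) : EuclideanSpace ℝ (Fin 3)) (r / 20) :=
    Metric.mem_ball_self (by positivity)
  refine ⟨1 - 9 * r ^ 2 / 40, ⟨by linarith, ht1⟩,
    (EuclideanSpace.single 0 (3 * r / 5) : EuclideanSpace ℝ (Fin 3)), ?_, ?_⟩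
  · rw [Metric.mem_ball, dist_zero_right, PiLp.norm_single, Real.norm_eq_abs, abs_of_pos (by positivity)]
    linarith
  · -- the per-slice floor of the sibling crux S2 with the constant amplitude `A := a t`
    have hfl := selfSimilarSwirl_loadFloor_pointwise (A := a (1 - 9 * r ^ 2 / 40)) (r := r)
      (ha _ ht1) hr _ ht _ hx
    dsimp only at hfl ⊢
    refine lt_of_lt_of_le ?_ hfl
    have hat : (2 : ℝ) ^ n ≤ a (1 - 9 * r ^ 2 / 40) := hpk n _ ht
    calc M < (2 : ℝ) ^ n * (expNegInvGlue 1 * (11 / 5)) := hnM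
      _ ≤ (2 : ℝ) ^ n * (expNegInvGlue 1 * (11 / 5)) / r := le_div_self (by positivity) hr hr1
      _ = (2 : ℝ) ^ n * (4 / r ^ 2) * expNegInvGlue 1 * (11 * r / 20) := by
          field_simp
          ring
      _ ≤ a (1 - 9 * r ^ 2 / 40) * (4 / r ^ 2) * expNegInvGlue 1 * (11 * r / 20) := by
          gcongr

end Summit.NavierStokesRegularity.NavierStokesRegularity.Theorems.SequentialTypeIExclusion.Registered

end
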